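import Summits.MatrixMultiplication.OmegaCensus.DicyclicLawRankThreeQuotient
import Summits.MatrixMultiplication.OmegaCensus.VertexCountingGap16
import HarnessLib

/-!
# The dicyclic law is not attained for ANY `A/⟨c₀⟩` of `2`-rank `≥ 3` — without a lower bound on `|A|`

ω-census `pub-omega`, family (b3), seat pub-omega-group gen 15.  Framing: lottery ticket; floor = certified bounds/negative
ranges.  VALUE: a kernel classification theorem about the group-theoretic method (TPP capacity of dihedral-like groups);
NOT progress on ω.

Gen 13's `no_dicyclic_law_of_rank_three_quot` (`DicyclicLawRankThreeQuotient.lean`) carries the hypothesis `|A| ≥ 50`, for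
one reason only: the shape classification `two_balanced_of_vertex_bounds31` needs `V ≥ 127`.  The dicyclic packing law
`3V + 16 = 8|A|` has total slack EXACTLY `16`, and `two_balanced_of_vertex_bounds16` (`VertexCountingGap16.lean`) gives the
same two balanced pairs from `V ≥ 31`.  Moreover `A/⟨c₀⟩ ↠ 𝔽₂³` forces `16 ∣ |A|` (`sixteen_dvd_card_of_onto_f2cube`),
and with `|A| ≡ 2 (mod 3)` (forced by the law) `|A| ≥ 32`, so the class theorems' hypothesis `|A| ≥ 28` is automatic.

**Theorem (`no_dicyclic_law_of_rank_three_quot'`).** Dicyclic type `G(A, c₀)` (`c₀ ≠ 0`), three homomorphisms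
`A →+ ZMod 2` killing `c₀` jointly onto `𝔽₂³`, `π : A →+ B` onto with kernel `{0, c₀}` (any finite abelian `B`): NO TPP
triple attains `3|S||T||U| + 16 = 8|A|` — for every `|A|`.  `no_dicyclic_law_of_onto_f2cube` is the same statement with
`π` constructed internally (`B = A/⟨c₀⟩`), so that an instance needs only the three characters.

New census consequence (the one order below `50`): `|A| = 32`, `|G| = 64`, quotient `A/⟨c₀⟩ ∈ {ℤ₂⁴, ℤ₂² × ℤ₄}` — the
groups `C₂² × Q₁₆ = G(ℤ₂²×ℤ₈,(0,0,4))` (NR115), `C₂³ × Q₈ = G(ℤ₂³×ℤ₄,(0,0,0,2))` (NR116), `C₂ × (ℤ₄ ⋊ Q₈) =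
G(ℤ₂×ℤ₄²,(0,2,0))` (NR119), `C₂² × (ℤ₄ ⋊ ℤ₄) = G(ℤ₂³×ℤ₄,(1,0,0,0))` (NR120) and the abelian `G(ℤ₂⁵, e₁)` do not attain
the dicyclic law `80` (engine rows ×2 so far; instances in `DicyclicLaw32.lean`).
-/

namespace Summit.MatrixMultiplication.OmegaCensus

open Literature.Combinatorics.Additive Finset

section Cardinality

variable {A : Type} [AddCommGroup A] [Fintype A] {B : Type} [AddCommGroup B] [Fintype B] {c₀ : A}

/-- If three homomorphisms `A →+ ZMod 2` kill `c₀ ≠ 0` and are jointly onto `𝔽₂³`, and `π : A ↠ B` has kernel `{0, c₀}`,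
then `16 ∣ |A|` (the characters factor through `B`, so `8 ∣ |B|`, and `|A| = 2|B|`). [folklore] -/
theorem sixteen_dvd_card_of_onto_f2cube (hc₀ : c₀ ≠ 0)
    (ψ₁ ψ₂ ψ₃ : A →+ ZMod 2) (hψc : ψ₁ c₀ = 0 ∧ ψ₂ c₀ = 0 ∧ ψ₃ c₀ = 0)
    (hψ : ∀ v : ZMod 2 × ZMod 2 × ZMod 2, ∃ x, (ψ₁ x, ψ₂ x, ψ₃ x) = v)
    (π : A →+ B) (hπ : Function.Surjective π) (hker : ∀ a : A, π a = 0 ↔ a = 0 ∨ a = c₀) :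
    16 ∣ Fintype.card A := by
  classical
  have hle : ∀ ψ : A →+ ZMod 2, ψ c₀ = 0 → π.ker ≤ ψ.ker := by
    intro ψ h0 a ha
    rw [AddMonoidHom.mem_ker] at ha ⊢
    rcases (hker a).1 ha with h1 | h1
    · rw [h1, map_zero]
    · rw [h1, h0]
  let φ₁ : B →+ ZMod 2 := π.liftOfSurjective hπ ⟨ψ₁, hle ψ₁ hψc.1⟩
  let φ₂ : B →+ ZMod 2 := π.liftOfSurjective hπ ⟨ψ₂, hle ψ₂ hψc.2.1⟩
  let φ₃ : B →+ ZMod 2 := π.liftOfSurjective hπ ⟨ψ₃, hle ψ₃ hψc.2.2⟩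
  have h₁ : ∀ a, φ₁ (π a) = ψ₁ a := fun a => π.liftOfRightInverse_comp_apply _ _ ⟨ψ₁, _⟩ a
  have h₂ : ∀ a, φ₂ (π a) = ψ₂ a := fun a => π.liftOfRightInverse_comp_apply _ _ ⟨ψ₂, _⟩ a
  have h₃ : ∀ a, φ₃ (π a) = ψ₃ a := fun a => π.liftOfRightInverse_comp_apply _ _ ⟨ψ₃, _⟩ a
  have hφ : ∀ v : ZMod 2 × ZMod 2 × ZMod 2, ∃ b, (φ₁ b, φ₂ b, φ₃ b) = v := by
    intro v
    obtain ⟨x, hx⟩ := hψ v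
    exact ⟨π x, by rw [h₁, h₂, h₃]; exact hx⟩
  have h8 : 8 ∣ Fintype.card B := eight_dvd_card_of_onto φ₁ φ₂ φ₃ hφ
  have h2 : Fintype.card A = 2 * Fintype.card B := card_eq_two_mul_of_ker_pair π hπ hc₀ hker
  obtain ⟨q, hq⟩ := h8
  exact ⟨q, by rw [h2, hq]; ring⟩

end Cardinality

section Assembly

variable {A : Type} [AddCommGroup A] [DecidableEq A] [Fintype A] {G : Type} [Group G] [DecidableEq G]
  {ρ τ : A → G} {c₀ : A} {B : Type} [AddCommGroup B] [DecidableEq B] [Fintype B]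

/-- **Core of the assembly: `S` and `T` balanced** — any quotient `A/⟨c₀⟩` of `2`-rank `≥ 3`, any `|A|`: no TPP triple with
`|S₀| = |S₁|` and `|T₀| = |T₁|` attains the dicyclic law (gen 13's `no_dicyclic_law_of_two_balanced_general` with the
hypothesis `|A| ≥ 50` replaced by `16 ∣ |A|`, which is automatic). [folklore] -/
theorem no_dicyclic_law_of_two_balanced_general'
    (hρρ : ∀ a b, ρ a * ρ b = ρ (a + b)) (hρτ : ∀ a b, ρ a * τ b = τ (b - a))
    (hτρ : ∀ a b, τ a * ρ b = τ (a + b)) (hττ : ∀ a b, τ a * τ b = ρ (c₀ + b - a)) (hc₀ : c₀ ≠ 0)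
    (hρ : Function.Injective ρ) (hτ : Function.Injective τ) (hne : ∀ a b, ρ a ≠ τ b)
    (hsurj : ∀ g, (∃ a, ρ a = g) ∨ (∃ a, τ a = g))
    (ψ₁ ψ₂ ψ₃ : A →+ ZMod 2) (hψc : ψ₁ c₀ = 0 ∧ ψ₂ c₀ = 0 ∧ ψ₃ c₀ = 0)
    (hψ : ∀ v : ZMod 2 × ZMod 2 × ZMod 2, ∃ x, (ψ₁ x, ψ₂ x, ψ₃ x) = v)
    (π : A →+ B) (hπ : Function.Surjective π) (hker : ∀ a : A, π a = 0 ↔ a = 0 ∨ a = c₀)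
    {S T U : Finset G} (h : TripleProductProperty S T U)
    (hs : (univ.filter fun a : A => ρ a ∈ S).card = (univ.filter fun a : A => τ a ∈ S).card)
    (ht : (univ.filter fun a : A => ρ a ∈ T).card = (univ.filter fun a : A => τ a ∈ T).card) :
    3 * (S.card * T.card * U.card) + 16 ≠ 8 * Fintype.card A := by
  intro hV
  have hmod : Fintype.card A % 3 = 2 := by omega
  obtain ⟨q₁₆, hq₁₆⟩ := sixteen_dvd_card_of_onto_f2cube hc₀ ψ₁ ψ₂ ψ₃ hψc hψ π hπ hker
  have hA28 : 28 ≤ Fintype.card A := by omega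
  obtain ⟨s, hs₀⟩ : ∃ s, (univ.filter fun a : A => ρ a ∈ S).card = s := ⟨_, rfl⟩
  obtain ⟨t, ht₀⟩ : ∃ t, (univ.filter fun a : A => ρ a ∈ T).card = t := ⟨_, rfl⟩
  obtain ⟨u₀, hu₀⟩ : ∃ u, (univ.filter fun a : A => ρ a ∈ U).card = u := ⟨_, rfl⟩
  obtain ⟨u₁, hu₁⟩ : ∃ u, (univ.filter fun a : A => τ a ∈ U).card = u := ⟨_, rfl⟩
  have hs₁ : (univ.filter fun a : A => τ a ∈ S).card = s := by rw [← hs, hs₀]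
  have ht₁ : (univ.filter fun a : A => τ a ∈ T).card = t := by rw [← ht, ht₀]
  have cS : S.card = s + s := by rw [card_eq_parts' hρ hτ hne hsurj S, hs₀, hs₁]
  have cT : T.card = t + t := by rw [card_eq_parts' hρ hτ hne hsurj T, ht₀, ht₁]
  have cU : U.card = u₀ + u₁ := by rw [card_eq_parts' hρ hτ hne hsurj U, hu₀, hu₁]
  obtain ⟨h000, h111, -⟩ := vertex_counting' hρρ hρτ hτρ hττ hρ hτ hne h
  rw [hs₀, hs₁, ht₀, ht₁, hu₀, hu₁] at h000 h111
  have hV' := hV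
  rw [cS, cT, cU] at hV'
  -- the unbalance `d` of `U` and the bound `s t d ≤ 4`
  obtain ⟨d, hd, hstd⟩ : ∃ d, (u₀ = u₁ + d ∨ u₁ = u₀ + d) ∧ s * t * d ≤ 4 := by
    rcases le_total u₁ u₀ with hle | hle
    · obtain ⟨d, rfl⟩ := Nat.exists_eq_add_of_le hle
      refine ⟨d, Or.inl rfl, ?_⟩
      have e1 : s * t * (u₁ + d) = s * t * u₁ + s * t * d := by ring
      have e2 : (s + s) * (t + t) * (u₁ + d + u₁) = 8 * (s * t * u₁) + 4 * (s * t * d) := by ring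
      rw [e1] at h000; rw [e2] at hV'; omega
    · obtain ⟨d, rfl⟩ := Nat.exists_eq_add_of_le hle
      refine ⟨d, Or.inr rfl, ?_⟩
      have e1 : s * t * (u₀ + d) = s * t * u₀ + s * t * d := by ring
      have e2 : (s + s) * (t + t) * (u₀ + (u₀ + d)) = 8 * (s * t * u₀) + 4 * (s * t * d) := by ring
      rw [e1] at h111; rw [e2] at hV'; omega
  -- class B
  rcases Nat.eq_zero_or_pos d with rfl | hdpos
  · have hu : (univ.filter fun a : A => ρ a ∈ U).card = (univ.filter fun a : A => τ a ∈ U).card := by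
      rw [hu₀, hu₁]; omega
    exact no_classB_dicyclic_law_general hρρ hρτ hτρ hττ hc₀ hρ hτ hne hsurj ψ₁ ψ₂ ψ₃ hψc hψ h hs ht hu hV
  have hU : (univ.filter fun a : A => ρ a ∈ U).card ≠ (univ.filter fun a : A => τ a ∈ U).card := by
    rw [hu₀, hu₁]; omega
  have hst : s * t ≤ 4 := le_trans (Nat.le_mul_of_pos_right _ hdpos) hstd
  -- `s, t ≥ 1`
  rcases Nat.eq_zero_or_pos s with rfl | hspos
  · simp at hV'; omega
  rcases Nat.eq_zero_or_pos t with rfl | htpos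
  · simp at hV'; omega
  have hs4 : s ≤ 4 := le_trans (Nat.le_mul_of_pos_right _ htpos) hst
  have ht4 : t ≤ 4 := le_trans (Nat.le_mul_of_pos_left _ hspos) hst
  interval_cases s <;> interval_cases t
  all_goals first
    | omega
    | -- two dominoes
      exact no_dicyclic_law_of_two_domino' hρρ hρτ hτρ hττ hc₀ hρ hτ hne hsurj hmod hA28 ψ₁ ψ₂ ψ₃ hψc hψ h hs₀ hs₁
        ht₀ ht₁ hV
    | -- class N1, roles `(S, T, U)`
      exact no_n1_dicyclic_law_general hρρ hρτ hτρ hττ hc₀ hρ hτ hne hsurj hmod hA28 ψ₁ ψ₂ ψ₃ hψc hψ π hπ hker h hs₀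
        hs₁ ht₀ ht₁ hU hV
    | -- class N1, roles `(T, S, U)`
      exact no_n1_dicyclic_law_general hρρ hρτ hτρ hττ hc₀ hρ hτ hne hsurj hmod hA28 ψ₁ ψ₂ ψ₃ hψc hψ π hπ hker
        (tpp_reverse h).rotate ht₀ ht₁ hs₀ hs₁ hU
        (by rw [show T.card * S.card * U.card = S.card * T.card * U.card by ring]; exact hV)
    | -- class N3
      exact no_n3_dicyclic_law_general hρρ hρτ hτρ hττ hc₀ hρ hτ hne hsurj hmod hA28 ψ₁ ψ₂ ψ₃ hψc hψ h hs₀ hs₁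
        ht₀ ht₁ hV
    | -- class N2, roles `(S, U, T)`
      exact no_n2_dicyclic_law_general hρρ hρτ hτρ hττ hc₀ hρ hτ hne hsurj hmod hA28 ψ₁ ψ₂ ψ₃ hψc hψ
        (tpp_reverse h).rotate.rotate hs₀ hs₁ ht₀ ht₁
        (by rw [show S.card * U.card * T.card = S.card * T.card * U.card by ring]; exact hV)
    | -- class N2, roles `(T, U, S)`
      exact no_n2_dicyclic_law_general hρρ hρτ hτρ hττ hc₀ hρ hτ hne hsurj hmod hA28 ψ₁ ψ₂ ψ₃ hψc hψ
        h.rotate ht₀ ht₁ hs₀ hs₁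
        (by rw [show T.card * U.card * S.card = S.card * T.card * U.card by ring]; exact hV)

/-- **The dicyclic law is not attained when `A/⟨c₀⟩` maps onto `𝔽₂³` — every order.**  Dicyclic type `G(A, c₀)` (`c₀ ≠ 0`),
three homomorphisms `A →+ ZMod 2` killing `c₀` jointly onto `𝔽₂³`, `π : A ↠ B` with kernel `{0, c₀}`.  For every TPP
triple `(S, T, U)`: `3|S||T||U| + 16 ≠ 8|A|`. [folklore] -/
theorem no_dicyclic_law_of_rank_three_quot'
    (hρρ : ∀ a b, ρ a * ρ b = ρ (a + b)) (hρτ : ∀ a b, ρ a * τ b = τ (b - a))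
    (hτρ : ∀ a b, τ a * ρ b = τ (a + b)) (hττ : ∀ a b, τ a * τ b = ρ (c₀ + b - a)) (hc₀ : c₀ ≠ 0)
    (hρ : Function.Injective ρ) (hτ : Function.Injective τ) (hne : ∀ a b, ρ a ≠ τ b)
    (hsurj : ∀ g, (∃ a, ρ a = g) ∨ (∃ a, τ a = g))
    (ψ₁ ψ₂ ψ₃ : A →+ ZMod 2) (hψc : ψ₁ c₀ = 0 ∧ ψ₂ c₀ = 0 ∧ ψ₃ c₀ = 0)
    (hψ : ∀ v : ZMod 2 × ZMod 2 × ZMod 2, ∃ x, (ψ₁ x, ψ₂ x, ψ₃ x) = v)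
    (π : A →+ B) (hπ : Function.Surjective π) (hker : ∀ a : A, π a = 0 ↔ a = 0 ∨ a = c₀)
    {S T U : Finset G} (h : TripleProductProperty S T U) :
    3 * (S.card * T.card * U.card) + 16 ≠ 8 * Fintype.card A := by
  intro hV
  obtain ⟨q₁₆, hq₁₆⟩ := sixteen_dvd_card_of_onto_f2cube hc₀ ψ₁ ψ₂ ψ₃ hψc hψ π hπ hker
  obtain ⟨h000, h111, h100, h011, h010, h101, h001, h110⟩ := vertex_counting' hρρ hρτ hτρ hττ hρ hτ hne h
  have hV' := hV
  rw [card_eq_parts' hρ hτ hne hsurj S, card_eq_parts' hρ hτ hne hsurj T, card_eq_parts' hρ hτ hne hsurj U] at hV'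
  rcases two_balanced_of_vertex_bounds16 _ _ _ _ _ _ _ h000 h111 h100 h011 h010 h101 h001 h110 (by omega)
      (by omega) with ⟨hs, ht⟩ | ⟨hs, hu⟩ | ⟨ht, hu⟩
  · exact no_dicyclic_law_of_two_balanced_general' hρρ hρτ hτρ hττ hc₀ hρ hτ hne hsurj ψ₁ ψ₂ ψ₃ hψc hψ π hπ hker h
      hs ht hV
  · -- rotate to `(U, S, T)`
    have := no_dicyclic_law_of_two_balanced_general' hρρ hρτ hτρ hττ hc₀ hρ hτ hne hsurj ψ₁ ψ₂ ψ₃ hψc hψ π hπ hker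
      h.rotate.rotate hu hs
    exact this (by rw [show U.card * S.card * T.card = S.card * T.card * U.card by ring]; exact hV)
  · -- rotate to `(T, U, S)`
    have := no_dicyclic_law_of_two_balanced_general' hρρ hρτ hτρ hττ hc₀ hρ hτ hne hsurj ψ₁ ψ₂ ψ₃ hψc hψ π hπ hker
      h.rotate ht hu
    exact this (by rw [show T.card * U.card * S.card = S.card * T.card * U.card by ring]; exact hV)

/-- **The same with the quotient map constructed internally** (`B = A/⟨c₀⟩`): dicyclic type `G(A, c₀)` (`c₀ ≠ 0`) and three
homomorphisms `A →+ ZMod 2` killing `c₀` jointly onto `𝔽₂³` ⇒ no TPP triple attains `3|S||T||U| + 16 = 8|A|`. [folklore] -/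
theorem no_dicyclic_law_of_onto_f2cube
    (hρρ : ∀ a b, ρ a * ρ b = ρ (a + b)) (hρτ : ∀ a b, ρ a * τ b = τ (b - a))
    (hτρ : ∀ a b, τ a * ρ b = τ (a + b)) (hττ : ∀ a b, τ a * τ b = ρ (c₀ + b - a)) (hc₀ : c₀ ≠ 0)
    (hρ : Function.Injective ρ) (hτ : Function.Injective τ) (hne : ∀ a b, ρ a ≠ τ b)
    (hsurj : ∀ g, (∃ a, ρ a = g) ∨ (∃ a, τ a = g))
    (ψ₁ ψ₂ ψ₃ : A →+ ZMod 2) (hψc : ψ₁ c₀ = 0 ∧ ψ₂ c₀ = 0 ∧ ψ₃ c₀ = 0)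
    (hψ : ∀ v : ZMod 2 × ZMod 2 × ZMod 2, ∃ x, (ψ₁ x, ψ₂ x, ψ₃ x) = v)
    {S T U : Finset G} (h : TripleProductProperty S T U) :
    3 * (S.card * T.card * U.card) + 16 ≠ 8 * Fintype.card A := by
  classical
  have h2c₀ : c₀ + c₀ = 0 := two_c0_eq_zero hρτ hτρ hττ hτ
  let K : AddSubgroup A := AddSubgroup.zmultiples c₀
  let π : A →+ A ⧸ K := QuotientAddGroup.mk' K
  have hker : ∀ x : A, π x = 0 ↔ x = 0 ∨ x = c₀ := by
    intro x
    rw [QuotientAddGroup.mk'_apply, QuotientAddGroup.eq_zero_iff]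
    exact mem_zmultiples_of_two h2c₀ x
  have hπ : Function.Surjective π := QuotientAddGroup.mk'_surjective K
  exact no_dicyclic_law_of_rank_three_quot' hρρ hρτ hτρ hττ hc₀ hρ hτ hne hsurj ψ₁ ψ₂ ψ₃ hψc hψ π hπ hker h

end Assembly

end Summit.MatrixMultiplication.OmegaCensus
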